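import Summits.QuantumFields.BalabanUV.Beta.GAN24.TransportRows
import Summits.QuantumFields.BalabanUV.Beta.MixedJetTablesPlug

/-!
# `BalabanUV.Beta.GAN24.TransportRowsRoot` — binder row G-an2-4 / (CONV-C), W-slot road «W3»: END #1's SOCKET CERTIFICATE (`TransportRows.t2Shape_three_of_rows_F3`)
# AT THE ROOTED BORDER `vh₂SAt (toSite r) Lc` (`r ∈ box (3+1) Lc`) — referee r53 (w9) ROOT ALIGNMENT, row (B) of the row owner's `SLOT-COVERAGE.md`
# (the β-lead's literal `MixedJetTablesPlug.JsBalAn1` / `JsBalAn1Ctr`, road BF-x's family)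

NOT IN PRINT; OUR PROOF ATTEMPT (row owner b2b-balaban-gan24-p1, gen 6).  [folklore] composition: the proofs of leaf-10/12/19's `TransportRows.t2Shape_three_of_rows_F3(_record)`
and `T2SlotOfHW.locStencil₂_unitS₂_T2Of_zero` VERBATIM with an1's base border `vh₂S d Lc = vh₂SAt 0 Lc` replaced by the rooted border `vh₂SAt (toSite r) Lc`
(`AveragingMixedJetTables.biLoc_vh₂SAt`, box root); the F3 rows (`transport_rows_three_symZ`) and END #1 (`WSlotT2OfPieces.t2Shape_of_rows`) are border-free and used BY NAME.
HONEST FRAMING (cell contract, verbatim): «discharging `BetaPertH` makes Bałaban's UV stability UNCONDITIONAL — a real constructive-QFT result; it is NOT the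
continuum limit and NOT the Clay problem.»  HONEST DEPENDENCY (verbatim): «continuum YM on T⁴ ⇐ BetaPertH ∧ nine spine estimates (0/9 proved); BetaPertH ⇐ (D1)
∧ (D4) ∧ CAP+tail; G-an2-4 gates asym, D1 and NE2/3/4.»  Discharges NOTHING by itself (rows `hsplit`/`hb`/`hZ` and the pin stay binders); 0 `def`, 0 cite,
0 `def … : Prop`, 0 sorry; NOT «W-slot closed», NEVER «G-an2-4 closed», NOT (CONV-C) for `G_k/H_k`; NOT BetaPertH, NOT continuum, NOT Clay.
-/

noncomputable section

open Finset
open scoped BigOperators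
open Literature.MathematicalPhysics.QuantumFieldTheory
open Literature.MathematicalPhysics.QuantumFieldTheory.Balaban1983to89
open Literature.MathematicalPhysics.QuantumFieldTheory.Balaban1983to89.Beta
open AffineAveraging (box toSite)
open ExpKernelCalculus (MKer Decays shiftK)
open OneStepResolventKernel (Fib)
open OneStepKernelFamily (KInvStep)
open StepJetData (mfNeg)
open Summit.QuantumFields.BalabanUV.Beta.HessKerDressedUnits (unitK)
open BalabanCompositeJets (LocStencil₂ LocStencil₂.nonneg)
open BalabanStepW2 (T2Of locStencil₂_smul' locStencil₂_add' locStencil₂_mfNeg)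
open WilsonBiStencil (wilsonW₂ wBound₂ biLoc_wilsonW₂)
open AveragingMixedJetTables (vh₂SAt vh2Abs biLoc_vh₂SAt)
open Summit.QuantumFields.BalabanUV.Beta.SecondOrderUnits (unitS₂)
open Summit.QuantumFields.BalabanUV.Beta.GAN24.CombesThomas (UnitDecayK sfStep smStep)
open Summit.QuantumFields.BalabanUV.Beta.GAN24.T2RecursionAffine (lin4)
open Summit.QuantumFields.BalabanUV.Beta.GAN24.Push4Iter (BiTab)
open Summit.QuantumFields.BalabanUV.Beta.GAN24.AffineUnroll (transport)
open Summit.QuantumFields.BalabanUV.Beta.GAN24.BiStencilZeroMode (zmode)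
open Summit.QuantumFields.BalabanUV.Beta.GAN24.TransportIrrelevantSym (zfreeSym_of_zfree)
open Summit.QuantumFields.BalabanUV.Beta.GAN24.WSlotT2OfPieces (shape_of_rows)
open Summit.QuantumFields.BalabanUV.Beta.GAN24.T2SlotUnits (unitS₂_T2Of_zero)
open Summit.QuantumFields.BalabanUV.Beta.GAN24.TransportRows (inv_natCast_nonneg inv_natCast_lt_one transport_rows_three_symZ)

namespace Summit.QuantumFields.BalabanUV.Beta.GAN24.TransportRowsRoot

section Zero

variable {d : ℕ} {Lc : ℕ} [NeZero Lc] {r : Fin (d + 1) → ℕ}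

/-- [folklore] **ROW W3-F4c AT THE ROOTED BORDER**: member `0` of the normalised family `unitS₂_0 (T2Of … (vh₂SAt (toSite r) Lc) mixFF 0) = cE₂•wilsonW₂ + cB•mfNeg ∘ vh₂SAt`
is a `LocStencil₂` family at EVERY rate `δ ≥ 0` (finite range), constant `|cE₂|·wBound₂·e^{8δ} + |cB|·vh2Abs (toSite r)·e^{6(d+1)Lc δ}` — `T2SlotOfHW.locStencil₂_unitS₂_T2Of_zero`
with `biLoc_vh₂SAt` (box root) for `locStencil₂_vh₂S`. -/
theorem locStencil₂_unitS₂_T2Of_zero_at (hLc : 1 ≤ Lc) (hr : r ∈ box (d + 1) Lc) (cE cVH cΛ cE₂ cB : ℝ) (T : Fin 4 → Fin 4 → Fin 4 → Fin 4 → ℝ)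
    (mixFF : Fin (d + 1) → (Fin (d + 1) → ℤ) → Fin (d + 1) → (Fin (d + 1) → ℤ) → MKer (d + 1) (Fib d)) {δ : ℝ} (hδ : 0 ≤ δ) :
    LocStencil₂ (unitS₂ (sfStep Lc 0) (smStep d Lc 0) (T2Of d Lc cE cVH cΛ cE₂ cB T (vh₂SAt (toSite r) Lc) mixFF 0))
      (|cE₂| * (wBound₂ d T * Real.exp (8 * δ)) + |cB| * (vh2Abs (toSite r) Lc * Real.exp (6 * ((d : ℝ) + 1) * Lc * δ))) δ := by
  rw [unitS₂_T2Of_zero]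
  have hWil : LocStencil₂ (wilsonW₂ d T) (wBound₂ d T * Real.exp (8 * δ)) δ := fun κ u κ' u' => biLoc_wilsonW₂ T hδ κ u κ' u'
  have hB : LocStencil₂ (vh₂SAt (toSite r) Lc) (vh2Abs (toSite r) Lc * Real.exp (6 * ((d : ℝ) + 1) * Lc * δ)) δ :=
    fun κ u κ' u' => biLoc_vh₂SAt hLc hr hδ κ u κ' u'
  exact locStencil₂_add' (locStencil₂_smul' cE₂ hWil) (locStencil₂_smul' cB (locStencil₂_mfNeg hB))

end Zero

section Three

variable {Lc : ℕ} [NeZero Lc] {CK mK : ℝ} {r : Fin (3 + 1) → ℕ}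

/-- **SOCKET CERTIFICATE, END #1 (`ZfreeSym` form) AT THE ROOTED BORDER `vh₂SAt (toSite r) Lc`**: `TransportRows.t2Shape_three_of_rows_F3` VERBATIM with the tower
`T♮_j := unitS₂_j (T2Of 3 Lc cE cVH cΛ cE₂ cB Tc (vh₂SAt (toSite r) Lc) mixFF j)`; F3a/F3b by `transport_rows_three_symZ` (border-free), F4c by `locStencil₂_unitS₂_T2Of_zero_at`;
`hsplit` (F1a), `hb` (F4a), `hZ` (F2a) and the pin remain the END's binders at this instantiation. -/
theorem t2Shape_three_of_rows_F3_at (hLc : 2 ≤ Lc) (hr : r ∈ box (3 + 1) Lc) (hK : UnitDecayK 3 Lc (sfStep Lc) (smStep 3 Lc) CK mK) (hmK : 0 < mK)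
    (cE cVH cΛ cE₂ cB : ℝ) (Tc : Fin 4 → Fin 4 → Fin 4 → Fin 4 → ℝ) (mixFF : BiTab 3) (b : ℕ → BiTab 3) (mom : BiTab 3 → ℝ)
    {δin Cb : ℝ} (hδin : 0 < δin) (hpin : |cE₂| ≤ (Lc : ℝ) ^ (2 * (3 + 1)))
    (hsplit : ∀ n, unitS₂ (sfStep Lc n) (smStep 3 Lc n) (T2Of 3 Lc cE cVH cΛ cE₂ cB Tc (vh₂SAt (toSite r) Lc) mixFF n) =
      transport (fun j => lin4 (cE₂ * (Lc : ℝ) ^ (2 * (3 + 1))) (unitK (sfStep Lc j) (smStep 3 Lc j) (KInvStep (d := 3) Lc j)) Lc) 0 n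
          (unitS₂ (sfStep Lc 0) (smStep 3 Lc 0) (T2Of 3 Lc cE cVH cΛ cE₂ cB Tc (vh₂SAt (toSite r) Lc) mixFF 0)) +
        ∑ i ∈ Finset.range n, transport (fun j => lin4 (cE₂ * (Lc : ℝ) ^ (2 * (3 + 1))) (unitK (sfStep Lc j) (smStep 3 Lc j) (KInvStep (d := 3) Lc j)) Lc)
          (i + 1) (n - 1 - i) (b i))
    (hb : ∀ m, LocStencil₂ (b m) Cb δin ∧ mom (b m) ≤ Cb)
    (hZ : ∀ m, (∀ κ u κ' u' t, b m κ (u + (Lc : ℤ) • t) κ' (u' + (Lc : ℤ) • t) = shiftK (-((Lc : ℤ) • t)) (b m κ u κ' u')) ∧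
      (∀ κ κ' κ₁ κ₂, zmode Lc (b m) κ κ' (Sum.inl κ₁) (Sum.inl κ₂) + zmode Lc (b m) κ' κ (Sum.inl κ₁) (Sum.inl κ₂) = 0)) :
    ∃ C₂ δ₂ : ℝ, 0 < δ₂ ∧ ∀ j, LocStencil₂ (unitS₂ (sfStep Lc j) (smStep 3 Lc j) (T2Of 3 Lc cE cVH cΛ cE₂ cB Tc (vh₂SAt (toSite r) Lc) mixFF j)) C₂ δ₂ := by
  have hLc1 : 1 ≤ Lc := le_trans (by norm_num) hLc
  obtain ⟨CT, CT', δT, -, hCT', hδT, -, hT, hTirr⟩ := transport_rows_three_symZ hLc1 hK hmK cE₂ hδin mom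
  exact ⟨_, δT, hδT, shape_of_rows (d := 3)
    (fun n => unitS₂ (sfStep Lc n) (smStep 3 Lc n) (T2Of 3 Lc cE cVH cΛ cE₂ cB Tc (vh₂SAt (toSite r) Lc) mixFF n)) b
    (transport (fun j => lin4 (cE₂ * (Lc : ℝ) ^ (2 * (3 + 1))) (unitK (sfStep Lc j) (smStep 3 Lc j) (KInvStep (d := 3) Lc j)) Lc))
    (fun X => (∀ κ u κ' u' t, X κ (u + (Lc : ℤ) • t) κ' (u' + (Lc : ℤ) • t) = shiftK (-((Lc : ℤ) • t)) (X κ u κ' u')) ∧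
      (∀ κ κ' κ₁ κ₂, zmode Lc X κ κ' (Sum.inl κ₁) (Sum.inl κ₂) + zmode Lc X κ' κ (Sum.inl κ₁) (Sum.inl κ₂) = 0))
    mom hCT' inv_natCast_nonneg (inv_natCast_lt_one hLc) hsplit (hT hpin) (hTirr hpin) hb hZ
    (locStencil₂_unitS₂_T2Of_zero_at (d := 3) hLc1 hr cE cVH cΛ cE₂ cB Tc mixFF hδin.le)⟩

/-- **SOCKET CERTIFICATE, END #1 (record-`Zfree` form) AT THE ROOTED BORDER** — via `zfreeSym_of_zfree`. -/
theorem t2Shape_three_of_rows_F3_record_at (hLc : 2 ≤ Lc) (hr : r ∈ box (3 + 1) Lc) (hK : UnitDecayK 3 Lc (sfStep Lc) (smStep 3 Lc) CK mK) (hmK : 0 < mK)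
    (cE cVH cΛ cE₂ cB : ℝ) (Tc : Fin 4 → Fin 4 → Fin 4 → Fin 4 → ℝ) (mixFF : BiTab 3) (b : ℕ → BiTab 3) (mom : BiTab 3 → ℝ)
    {δin Cb : ℝ} (hδin : 0 < δin) (hpin : |cE₂| ≤ (Lc : ℝ) ^ (2 * (3 + 1)))
    (hsplit : ∀ n, unitS₂ (sfStep Lc n) (smStep 3 Lc n) (T2Of 3 Lc cE cVH cΛ cE₂ cB Tc (vh₂SAt (toSite r) Lc) mixFF n) =
      transport (fun j => lin4 (cE₂ * (Lc : ℝ) ^ (2 * (3 + 1))) (unitK (sfStep Lc j) (smStep 3 Lc j) (KInvStep (d := 3) Lc j)) Lc) 0 n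
          (unitS₂ (sfStep Lc 0) (smStep 3 Lc 0) (T2Of 3 Lc cE cVH cΛ cE₂ cB Tc (vh₂SAt (toSite r) Lc) mixFF 0)) +
        ∑ i ∈ Finset.range n, transport (fun j => lin4 (cE₂ * (Lc : ℝ) ^ (2 * (3 + 1))) (unitK (sfStep Lc j) (smStep 3 Lc j) (KInvStep (d := 3) Lc j)) Lc)
          (i + 1) (n - 1 - i) (b i))
    (hb : ∀ m, LocStencil₂ (b m) Cb δin ∧ mom (b m) ≤ Cb)
    (hZ : ∀ m, (∀ κ u κ' u' t, b m κ (u + (Lc : ℤ) • t) κ' (u' + (Lc : ℤ) • t) = shiftK (-((Lc : ℤ) • t)) (b m κ u κ' u')) ∧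
      (∀ κ κ' κ₁ κ₂, zmode Lc (b m) κ κ' (Sum.inl κ₁) (Sum.inl κ₂) = 0)) :
    ∃ C₂ δ₂ : ℝ, 0 < δ₂ ∧ ∀ j, LocStencil₂ (unitS₂ (sfStep Lc j) (smStep 3 Lc j) (T2Of 3 Lc cE cVH cΛ cE₂ cB Tc (vh₂SAt (toSite r) Lc) mixFF j)) C₂ δ₂ :=
  t2Shape_three_of_rows_F3_at hLc hr hK hmK cE cVH cΛ cE₂ cB Tc mixFF b mom hδin hpin hsplit hb (fun m => zfreeSym_of_zfree (hZ m))

end Three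

end Summit.QuantumFields.BalabanUV.Beta.GAN24.TransportRowsRoot

end
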